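import Summits.ValiantsHypothesis.ValiantsHypothesis.Theorems.LacunarySymmetroidMatrixDescartesDoorA26WallBubblingThreePairChainSplit
import Summits.ValiantsHypothesis.ValiantsHypothesis.Theorems.LacunarySymmetroidMatrixDescartesDoorA26WallBubblingThreePairRungsA
import Summits.ValiantsHypothesis.ValiantsHypothesis.Theorems.LacunarySymmetroidMatrixDescartesDoorA26WallBubblingThreePairRungsB
import Summits.ValiantsHypothesis.ValiantsHypothesis.Theorems.LacunarySymmetroidMatrixDescartesDoorA26WallBubblingThreePairRungsC
import Summits.ValiantsHypothesis.ValiantsHypothesis.Theorems.LacunarySymmetroidMatrixDescartesDoorA26WallBubblingThreePairRungsD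
import Summits.ValiantsHypothesis.ValiantsHypothesis.Theorems.LacunarySymmetroidMatrixDescartesDoorA26WallBubblingThreePairRungsE
import Summits.ValiantsHypothesis.ValiantsHypothesis.Theorems.LacunarySymmetroidMatrixDescartesDoorA26WallBubblingThreePairClusters
import Summits.ValiantsHypothesis.ValiantsHypothesis.Theorems.LacunarySymmetroidMatrixDescartesDoorA26WallBubblingThreePairMonotone
import Summits.ValiantsHypothesis.ValiantsHypothesis.Theorems.LacunarySymmetroidMatrixDescartesDoorA26WallBubblingThreePairSlots
import Summits.ValiantsHypothesis.ValiantsHypothesis.Theorems.LacunarySymmetroidMatrixDescartesDoorA26WallBubblingThreePairNondeg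
import Summits.ValiantsHypothesis.ValiantsHypothesis.Theorems.LacunarySymmetroidMatrixDescartesDoorA26WallBubblingThreePairCount
import Summits.ValiantsHypothesis.ValiantsHypothesis.Theorems.LacunarySymmetroidMatrixDescartesDoorA26WallBubblingConfluentTower

/-!
# Wall bubbling for `DoorA26` — THE VALUE-GENERIC THREE-PAIR CHAIN (`ValueGenericThreePairChain26` proved)

HONEST FRAMING.  `ValueGenericThreePairChain26` of `Cruxes/DoorA26/Lines/wall_bubbling_ConfluentDoor.lean` (rev 7: W1 g13 #44's binder `hVG3`
byte-exact; crux `DoorA26`, stmt-ValiantsHypothesis-19979 — OPEN, typed, never asserted): «no sequence of genuine symmetric (2,6) pencils with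
twenty log-zeros at every stage has exponents converging to a VALUE-GENERIC point with THREE Weyl pairs (`δ0 5 = δ0 0`, `δ0 4 = δ0 1`,
`δ0 3 = δ0 2`; a coincidence of pair sums of the three values is a coincidence of the pairs)».  W1 seat val-sym-door-p2 g14.

* `threePair_clusters_monotone` — W1 #70 `threePair_twoScale_monotone` in cluster currency (change of centre, W2's `recenter_shift`).
* **`valueGenericThreePairChain : ‹body of ValueGenericThreePairChain26, verbatim›`** — THE ASSEMBLY (W1 #61's two-pair assembly at three pairs):
  clusters and their Gram-normalised three-dslope limits (W1 #71 `threePairClusters_of_nondeg`, non-degeneracy by W1 #32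
  `threePairDet_ne_zero_of_polar_ne_zero` from value-genericity); per-cluster Laguerre–Pólya count in member language (W1 #39
  `threePairDet_zerosWithMultiplicityLE_slots` through `multiplicity_transfer_iteratedDeriv`); tropical monotonicity (above); slot splitting
  (this seat's `threePair_hsplit`, fed by the eighteen rungs W1 #72–#76 — pure classes TOP/MID/THREE-SCALE, mixed classes the face rules
  `MixTop26`/`MixMid26`/`MixThree26'` transported, the last one using the symmetry of the letters and `δ_a ≠ δ_b` from value-genericity);
  the chain ceiling (W2 `chain_ceiling`) with `|V| ≤ 6` values (W1 #30 `card_pairSums_three`) and `n_w = 3` for every value: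
  `20 = Σ_c m_c ≤ 2·|V| + (|V| − 1) ≤ 17` — contradiction.

So the line lead can link `ValueGenericThreePairChain26` by `exact valueGenericThreePairChain`; with rev 12's ledger this leaves
«(W) ⟸ ConfluentDoor26 ∧ NoTightChain26NC ∧ (M) ∧ TripleStratum26».  Nothing here asserts (W), (M), any door, `DoorA26` (19979) or
`MatrixDescartes` (18050); VP ≠ VNP is not moved.  Def-free.  `--supports stmt-ValiantsHypothesis-19979 --as helper`.
-/

-- `Summit.ValiantsHypothesis.ValiantsHypothesis.…` repeats a component by the D-0017 layout
-- (single-conjunct summit), which the `dupNamespace` linter flags; the name is mandated.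
set_option linter.dupNamespace false

namespace Summit.ValiantsHypothesis.ValiantsHypothesis.Theorems.LacunarySymmetroidMatrixDescartes.WallBubbling

open Finset Filter Topology
open Bubbling (polar polar_comm)
open Literature.Analysis.TotalPositivity.LaguerreRuleOfSigns (ZerosWithMultiplicityLE)
open scoped BigOperators

/-- **TROPICAL MONOTONICITY BETWEEN TWO CLUSTERS AT THREE PAIRS** (W1 #70 in cluster currency).  Clusters at centres `s c k`, `c < c'`
drifting apart; Gram-normalised three-dslope frames of the recentred letters converging at both: an entry alive at `c` has limit value at most
that of any entry alive at `c'`. [this work] -/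
theorem threePair_clusters_monotone (δs : ℕ → Fin 6 → ℝ) (δ0 : Fin 6 → ℝ)
    (hδ : ∀ l, Tendsto (fun k => δs k l) atTop (𝓝 (δ0 l))) (h50 : δ0 5 = δ0 0) (h41 : δ0 4 = δ0 1) (h32 : δ0 3 = δ0 2)
    (U : ℕ → Fin 6 → Matrix (Fin 2) (Fin 2) ℝ) {C : ℕ} (s : Fin C → ℕ → ℝ)
    (μ : Fin C → ℕ → ℝ) (Γ : Fin C → Fin 6 → Fin 6 → ℝ) (hμ : ∀ c k, 0 < μ c k)
    (hdom : ∀ c k, ∀ a b : Fin 6, |polar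
      (if a = 0 then Real.exp (δs k 0 * s c k) • U k 0 + Real.exp (δs k 5 * s c k) • U k 5
        else if a = 1 then Real.exp (δs k 1 * s c k) • U k 1 + Real.exp (δs k 4 * s c k) • U k 4
        else if a = 2 then Real.exp (δs k 2 * s c k) • U k 2 + Real.exp (δs k 3 * s c k) • U k 3
        else if a = 3 then (δs k 3 - δs k 2) • (Real.exp (δs k 3 * s c k) • U k 3)
        else if a = 4 then (δs k 4 - δs k 1) • (Real.exp (δs k 4 * s c k) • U k 4) else (δs k 5 - δs k 0) • (Real.exp (δs k 5 * s c k) • U k 5))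
      (if b = 0 then Real.exp (δs k 0 * s c k) • U k 0 + Real.exp (δs k 5 * s c k) • U k 5
        else if b = 1 then Real.exp (δs k 1 * s c k) • U k 1 + Real.exp (δs k 4 * s c k) • U k 4
        else if b = 2 then Real.exp (δs k 2 * s c k) • U k 2 + Real.exp (δs k 3 * s c k) • U k 3
        else if b = 3 then (δs k 3 - δs k 2) • (Real.exp (δs k 3 * s c k) • U k 3)
        else if b = 4 then (δs k 4 - δs k 1) • (Real.exp (δs k 4 * s c k) • U k 4) else (δs k 5 - δs k 0) • (Real.exp (δs k 5 * s c k) • U k 5))| ≤ μ c k)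
    (hΓ : ∀ c, ∀ a b : Fin 6, Tendsto (fun k => polar
      (if a = 0 then Real.exp (δs k 0 * s c k) • U k 0 + Real.exp (δs k 5 * s c k) • U k 5
        else if a = 1 then Real.exp (δs k 1 * s c k) • U k 1 + Real.exp (δs k 4 * s c k) • U k 4
        else if a = 2 then Real.exp (δs k 2 * s c k) • U k 2 + Real.exp (δs k 3 * s c k) • U k 3
        else if a = 3 then (δs k 3 - δs k 2) • (Real.exp (δs k 3 * s c k) • U k 3)
        else if a = 4 then (δs k 4 - δs k 1) • (Real.exp (δs k 4 * s c k) • U k 4) else (δs k 5 - δs k 0) • (Real.exp (δs k 5 * s c k) • U k 5))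
      (if b = 0 then Real.exp (δs k 0 * s c k) • U k 0 + Real.exp (δs k 5 * s c k) • U k 5
        else if b = 1 then Real.exp (δs k 1 * s c k) • U k 1 + Real.exp (δs k 4 * s c k) • U k 4
        else if b = 2 then Real.exp (δs k 2 * s c k) • U k 2 + Real.exp (δs k 3 * s c k) • U k 3
        else if b = 3 then (δs k 3 - δs k 2) • (Real.exp (δs k 3 * s c k) • U k 3)
        else if b = 4 then (δs k 4 - δs k 1) • (Real.exp (δs k 4 * s c k) • U k 4) else (δs k 5 - δs k 0) • (Real.exp (δs k 5 * s c k) • U k 5)) / μ c k)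
      atTop (𝓝 (Γ c a b)))
    (c c' : Fin C) (hL : Tendsto (fun k => s c' k - s c k) atTop atTop)
    (p q p' q' : Fin 6) (hpq : Γ c p q ≠ 0) (hp'q' : Γ c' p' q' ≠ 0) :
    δ0 p + δ0 q ≤ δ0 p' + δ0 q' := by
  have hshift : ∀ k l, Real.exp (δs k l * (s c' k - s c k)) • (Real.exp (δs k l * s c k) • U k l)
      = Real.exp (δs k l * s c' k) • U k l := fun k l => recenter_shift (δs k) (U k) (s c k) (s c' k) l
  refine threePair_twoScale_monotone δs δ0 hδ h50 h41 h32 (fun k l => Real.exp (δs k l * s c k) • U k l) (fun k => s c' k - s c k) hL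
    (μ c) (μ c') (hμ c) (hμ c') (hdom c) ?_ (Γ c) (Γ c') (hΓ c) ?_ p q p' q' hpq hp'q'
  · intro k a b; simp only [hshift]; exact hdom c' k a b
  · intro a b; simp only [hshift]; exact hΓ c' a b

/-- **THE VALUE-GENERIC THREE-PAIR CHAIN: NO TWENTIES ACCUMULATE AT A VALUE-GENERIC THREE-WEYL-PAIR POINT** — the body of
`ValueGenericThreePairChain26` (rev 7 of `Lines/wall_bubbling_ConfluentDoor.lean`), verbatim. [this work] -/
theorem valueGenericThreePairChain :
    ∀ (δs : ℕ → Fin 6 → ℝ) (δ0 : Fin 6 → ℝ), (∀ l, Tendsto (fun ν => δs ν l) atTop (𝓝 (δ0 l))) →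
      δ0 5 = δ0 0 → δ0 4 = δ0 1 → δ0 3 = δ0 2 →
      (∀ a b c e : Fin 3, δ0 a.castSucc.castSucc.castSucc + δ0 b.castSucc.castSucc.castSucc
          = δ0 c.castSucc.castSucc.castSucc + δ0 e.castSucc.castSucc.castSucc → (a = c ∧ b = e) ∨ (a = e ∧ b = c)) →
      ∀ (U : ℕ → Fin 6 → Matrix (Fin 2) (Fin 2) ℝ), (∀ ν l, (U ν l).IsSymm) →
      (∀ ν, ∃ t, (∑ l, Real.exp (δs ν l * t) • U ν l).det ≠ 0) →
      ∀ (z : ℕ → Fin 20 → ℝ), (∀ ν, StrictMono (z ν)) → (∀ ν i, (∑ l, Real.exp (δs ν l * z ν i) • U ν l).det = 0) → False := by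
  intro δs δ0 hδ h50 h41 h32 hvg U hU hne z hz hroot
  classical
  obtain ⟨φ, hφ, C, m, s, R, hm, -, hdrift, hzeros, μ, Γ, ε, W, hpkg⟩ :=
    threePairClusters_of_nondeg δs δ0 hδ h50 h41 h32 (threePairDet_ne_zero_of_polar_ne_zero δ0 h50 h41 h32 hvg) U hU hne z hz hroot
  have hμ : ∀ c k, 0 < μ c k := fun c => (hpkg c).1
  have hdom := fun c => (hpkg c).2.1
  have hΓ := fun c => (hpkg c).2.2.1
  have hε : ∀ c, ε c = 1 ∨ ε c = -1 := fun c => (hpkg c).2.2.2.1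
  have hΓW : ∀ c a b, Γ c a b = ε c * polar (W c a) (W c b) := fun c => (hpkg c).2.2.2.2.2.1
  have hneW := fun c => (hpkg c).2.2.2.2.2.2.1
  have hconv := fun c => (hpkg c).2.2.2.2.2.2.2
  have hδφ : ∀ l, Tendsto (fun k => δs (φ k) l) atTop (𝓝 (δ0 l)) := fun l => (hδ l).comp hφ.tendsto_atTop
  have hUφ : ∀ k l, (U (φ k) l).IsSymm := fun k l => hU (φ k) l
  -- alive members are the non-zero entries of `Γ`
  have hεne : ∀ c, ε c ≠ 0 := by
    intro c; rcases hε c with h | h <;> rw [h] <;> norm_num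
  have hal : ∀ c p q, polar (W c p) (W c q) ≠ 0 ↔ Γ c p q ≠ 0 := by
    intro c p q
    rw [hΓW]
    exact ⟨fun h => mul_ne_zero (hεne c) h, fun h hz0 => h (by rw [hz0, mul_zero])⟩
  have hΓsymm : ∀ c a b, Γ c a b = Γ c b a := by
    intro c a b; rw [hΓW, hΓW, polar_comm]
  -- value-genericity: the three values are distinct
  have h01 : δ0 0 ≠ δ0 1 := by
    intro h
    have h' := hvg 0 0 1 1 (by change δ0 0 + δ0 0 = δ0 1 + δ0 1; rw [h])
    revert h'; decide
  have h02 : δ0 0 ≠ δ0 2 := by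
    intro h
    have h' := hvg 0 0 2 2 (by change δ0 0 + δ0 0 = δ0 2 + δ0 2; rw [h])
    revert h'; decide
  have h12 : δ0 1 ≠ δ0 2 := by
    intro h
    have h' := hvg 1 1 2 2 (by change δ0 1 + δ0 1 = δ0 2 + δ0 2; rw [h])
    revert h'; decide
  -- tropical monotonicity and the eighteen rungs in cluster currency (W1 #70, #72–#76)
  have Rmono : ∀ c c' : Fin C, c < c' → ∀ p q p' q' : Fin 6, Γ c p q ≠ 0 → Γ c' p' q' ≠ 0 → δ0 p + δ0 q ≤ δ0 p' + δ0 q' :=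
    fun c c' hcc' p q p' q' h1 h2 => threePair_clusters_monotone (fun k => δs (φ k)) δ0 hδφ h50 h41 h32 (fun k => U (φ k)) s μ Γ hμ hdom hΓ
      c c' (hdrift c c' hcc') p q p' q' h1 h2
  have Rtop₀₅ : ∀ c c' : Fin C, c < c' → Γ c 5 5 ≠ 0 → Γ c' 5 5 = 0 ∧ Γ c' 0 5 = 0 :=
    fun c c' hcc' h1 => threePair_clusters_top₀₅ (fun k => δs (φ k)) δ0 hδφ h50 (fun k => U (φ k)) s μ Γ hμ hdom hΓ
      c c' (hdrift c c' hcc') h1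
  have Rmid₀₅ : ∀ c c' : Fin C, c < c' → Γ c 0 5 ≠ 0 → Γ c' 5 5 = 0 :=
    fun c c' hcc' h1 => threePair_clusters_mid₀₅ (fun k => δs (φ k)) δ0 hδφ h50 (fun k => U (φ k)) s μ Γ hμ hdom hΓ
      c c' (hdrift c c' hcc') h1
  have Rthree₀₅ : ∀ c₁ c₂ c₃ : Fin C, c₁ < c₂ → c₂ < c₃ → Γ c₁ 0 5 ≠ 0 → Γ c₂ 0 5 ≠ 0 → Γ c₃ 0 5 ≠ 0 → False :=
    fun c₁ c₂ c₃ h12' h23' h1 h2 h3 => threePair_clusters_three₀₅ (fun k => δs (φ k)) δ0 hδφ h50 (fun k => U (φ k)) s μ Γ hμ hdom hΓ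
      c₁ c₂ c₃ (hdrift c₁ c₂ h12') (hdrift c₂ c₃ h23') h1 h2 h3
  have Rtop₁₄ : ∀ c c' : Fin C, c < c' → Γ c 4 4 ≠ 0 → Γ c' 4 4 = 0 ∧ Γ c' 1 4 = 0 :=
    fun c c' hcc' h1 => threePair_clusters_top₁₄ (fun k => δs (φ k)) δ0 hδφ h41 (fun k => U (φ k)) s μ Γ hμ hdom hΓ
      c c' (hdrift c c' hcc') h1
  have Rmid₁₄ : ∀ c c' : Fin C, c < c' → Γ c 1 4 ≠ 0 → Γ c' 4 4 = 0 :=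
    fun c c' hcc' h1 => threePair_clusters_mid₁₄ (fun k => δs (φ k)) δ0 hδφ h41 (fun k => U (φ k)) s μ Γ hμ hdom hΓ
      c c' (hdrift c c' hcc') h1
  have Rthree₁₄ : ∀ c₁ c₂ c₃ : Fin C, c₁ < c₂ → c₂ < c₃ → Γ c₁ 1 4 ≠ 0 → Γ c₂ 1 4 ≠ 0 → Γ c₃ 1 4 ≠ 0 → False :=
    fun c₁ c₂ c₃ h12' h23' h1 h2 h3 => threePair_clusters_three₁₄ (fun k => δs (φ k)) δ0 hδφ h41 (fun k => U (φ k)) s μ Γ hμ hdom hΓ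
      c₁ c₂ c₃ (hdrift c₁ c₂ h12') (hdrift c₂ c₃ h23') h1 h2 h3
  have Rtop₂₃ : ∀ c c' : Fin C, c < c' → Γ c 3 3 ≠ 0 → Γ c' 3 3 = 0 ∧ Γ c' 2 3 = 0 :=
    fun c c' hcc' h1 => threePair_clusters_top₂₃ (fun k => δs (φ k)) δ0 hδφ h32 (fun k => U (φ k)) s μ Γ hμ hdom hΓ
      c c' (hdrift c c' hcc') h1
  have Rmid₂₃ : ∀ c c' : Fin C, c < c' → Γ c 2 3 ≠ 0 → Γ c' 3 3 = 0 :=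
    fun c c' hcc' h1 => threePair_clusters_mid₂₃ (fun k => δs (φ k)) δ0 hδφ h32 (fun k => U (φ k)) s μ Γ hμ hdom hΓ
      c c' (hdrift c c' hcc') h1
  have Rthree₂₃ : ∀ c₁ c₂ c₃ : Fin C, c₁ < c₂ → c₂ < c₃ → Γ c₁ 2 3 ≠ 0 → Γ c₂ 2 3 ≠ 0 → Γ c₃ 2 3 ≠ 0 → False :=
    fun c₁ c₂ c₃ h12' h23' h1 h2 h3 => threePair_clusters_three₂₃ (fun k => δs (φ k)) δ0 hδφ h32 (fun k => U (φ k)) s μ Γ hμ hdom hΓ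
      c₁ c₂ c₃ (hdrift c₁ c₂ h12') (hdrift c₂ c₃ h23') h1 h2 h3
  have Mtop₀₁ : ∀ c c' : Fin C, c < c' → Γ c 5 4 ≠ 0 → Γ c' 5 4 = 0 ∧ Γ c' 0 4 = 0 ∧ Γ c' 5 1 = 0 :=
    fun c c' hcc' h1 => threePair_clusters_mixTop₀₁ (fun k => δs (φ k)) δ0 hδφ h50 h41 (fun k => U (φ k)) s μ Γ hμ hdom hΓ
      c c' (hdrift c c' hcc') h1
  have Mmid₀₁ : ∀ c c' : Fin C, c < c' → (Γ c 0 4 ≠ 0 ∨ Γ c 5 1 ≠ 0) → Γ c' 5 4 = 0 :=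
    fun c c' hcc' h1 => threePair_clusters_mixMid₀₁ (fun k => δs (φ k)) δ0 hδφ h50 h41 (fun k => U (φ k)) s μ Γ hμ hdom hΓ
      c c' (hdrift c c' hcc') h1
  have Mthree₀₁ : ∀ c₁ c₂ c₃ : Fin C, c₁ < c₂ → c₂ < c₃ → (Γ c₁ 0 4 ≠ 0 ∨ Γ c₁ 5 1 ≠ 0) → (Γ c₂ 0 4 ≠ 0 ∨ Γ c₂ 5 1 ≠ 0) →
      (Γ c₃ 0 4 ≠ 0 ∨ Γ c₃ 5 1 ≠ 0) → False :=
    fun c₁ c₂ c₃ h12' h23' h1 h2 h3 => threePair_clusters_mixThree₀₁ (fun k => δs (φ k)) δ0 hδφ h50 h41 h01 (fun k => U (φ k)) hUφ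
      s μ Γ hμ hdom hΓ c₁ c₂ c₃ (hdrift c₁ c₂ h12') (hdrift c₂ c₃ h23') h1 h2 h3
  have Mtop₀₂ : ∀ c c' : Fin C, c < c' → Γ c 5 3 ≠ 0 → Γ c' 5 3 = 0 ∧ Γ c' 0 3 = 0 ∧ Γ c' 5 2 = 0 :=
    fun c c' hcc' h1 => threePair_clusters_mixTop₀₂ (fun k => δs (φ k)) δ0 hδφ h50 h32 (fun k => U (φ k)) s μ Γ hμ hdom hΓ
      c c' (hdrift c c' hcc') h1
  have Mmid₀₂ : ∀ c c' : Fin C, c < c' → (Γ c 0 3 ≠ 0 ∨ Γ c 5 2 ≠ 0) → Γ c' 5 3 = 0 :=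
    fun c c' hcc' h1 => threePair_clusters_mixMid₀₂ (fun k => δs (φ k)) δ0 hδφ h50 h32 (fun k => U (φ k)) s μ Γ hμ hdom hΓ
      c c' (hdrift c c' hcc') h1
  have Mthree₀₂ : ∀ c₁ c₂ c₃ : Fin C, c₁ < c₂ → c₂ < c₃ → (Γ c₁ 0 3 ≠ 0 ∨ Γ c₁ 5 2 ≠ 0) → (Γ c₂ 0 3 ≠ 0 ∨ Γ c₂ 5 2 ≠ 0) →
      (Γ c₃ 0 3 ≠ 0 ∨ Γ c₃ 5 2 ≠ 0) → False :=
    fun c₁ c₂ c₃ h12' h23' h1 h2 h3 => threePair_clusters_mixThree₀₂ (fun k => δs (φ k)) δ0 hδφ h50 h32 h02 (fun k => U (φ k)) hUφ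
      s μ Γ hμ hdom hΓ c₁ c₂ c₃ (hdrift c₁ c₂ h12') (hdrift c₂ c₃ h23') h1 h2 h3
  have Mtop₁₂ : ∀ c c' : Fin C, c < c' → Γ c 4 3 ≠ 0 → Γ c' 4 3 = 0 ∧ Γ c' 1 3 = 0 ∧ Γ c' 4 2 = 0 :=
    fun c c' hcc' h1 => threePair_clusters_mixTop₁₂ (fun k => δs (φ k)) δ0 hδφ h41 h32 (fun k => U (φ k)) s μ Γ hμ hdom hΓ
      c c' (hdrift c c' hcc') h1
  have Mmid₁₂ : ∀ c c' : Fin C, c < c' → (Γ c 1 3 ≠ 0 ∨ Γ c 4 2 ≠ 0) → Γ c' 4 3 = 0 :=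
    fun c c' hcc' h1 => threePair_clusters_mixMid₁₂ (fun k => δs (φ k)) δ0 hδφ h41 h32 (fun k => U (φ k)) s μ Γ hμ hdom hΓ
      c c' (hdrift c c' hcc') h1
  have Mthree₁₂ : ∀ c₁ c₂ c₃ : Fin C, c₁ < c₂ → c₂ < c₃ → (Γ c₁ 1 3 ≠ 0 ∨ Γ c₁ 4 2 ≠ 0) → (Γ c₂ 1 3 ≠ 0 ∨ Γ c₂ 4 2 ≠ 0) →
      (Γ c₃ 1 3 ≠ 0 ∨ Γ c₃ 4 2 ≠ 0) → False :=
    fun c₁ c₂ c₃ h12' h23' h1 h2 h3 => threePair_clusters_mixThree₁₂ (fun k => δs (φ k)) δ0 hδφ h41 h32 h12 (fun k => U (φ k)) hUφ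
      s μ Γ hμ hdom hΓ c₁ c₂ c₃ (hdrift c₁ c₂ h12') (hdrift c₂ c₃ h23') h1 h2 h3
  -- the value set, `|V| ≤ 6`
  set V : Finset ℝ := ((univ : Finset (Fin 6 × Fin 6)).image (fun pq => δ0 pq.1 + δ0 pq.2)) with hV
  have hmemV : ∀ p q : Fin 6, δ0 p + δ0 q ∈ V := fun p q => Finset.mem_image.mpr ⟨(p, q), Finset.mem_univ _, rfl⟩
  have hV6 : V.card ≤ 6 := by
    have hsub : V ⊆ (univ : Finset (Fin 3 × Fin 3)).image
        (fun pr => δ0 pr.1.castSucc.castSucc.castSucc + δ0 pr.2.castSucc.castSucc.castSucc) := by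
      intro w hw
      rw [hV, Finset.mem_image] at hw
      obtain ⟨pq, -, rfl⟩ := hw
      obtain ⟨a, ha, -⟩ := threePair_classes δ0 h50 h41 h32 pq.1
      obtain ⟨b, hb, -⟩ := threePair_classes δ0 h50 h41 h32 pq.2
      exact Finset.mem_image.mpr ⟨(a, b), Finset.mem_univ _, by rw [ha, hb]⟩
    exact (Finset.card_le_card hsub).trans (Bubbling.card_pairSums_three (fun a => δ0 a.castSucc.castSucc.castSucc)).1
  -- (hne) every cluster has an alive member
  have hne' : ∀ c : Fin C, (V.filter (fun w => (∃ p q : Fin 6, δ0 p + δ0 q = w ∧ polar (W c p) (W c q) ≠ 0))).Nonempty := by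
    intro c
    obtain ⟨p, q, hpq⟩ := exists_polar_ne_zero_of_threePairDet_ne_zero δ0 (W c) (hneW c)
    exact ⟨δ0 p + δ0 q, Finset.mem_filter.mpr ⟨hmemV p q, p, q, rfl, hpq⟩⟩
  -- (hcount) the Laguerre–Pólya count per cluster (W1 #39), through the multiplicity transfer
  have hcount : ∀ c : Fin C, m c + 1 ≤ ∑ w ∈ V.filter (fun w => (∃ p q : Fin 6, δ0 p + δ0 q = w ∧ polar (W c p) (W c q) ≠ 0)),
      ((if (∃ p q : Fin 6, δ0 p + δ0 q = w ∧ polar (W c p) (W c q) ≠ 0 ∧ (if p = 5 then 1 else if p = 4 then 1 else if p = 3 then 1 else 0) + (if q = 5 then 1 else if q = 4 then 1 else if q = 3 then 1 else 0) = 2) then 2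
          else if (∃ p q : Fin 6, δ0 p + δ0 q = w ∧ polar (W c p) (W c q) ≠ 0 ∧ (if p = 5 then 1 else if p = 4 then 1 else if p = 3 then 1 else 0) + (if q = 5 then 1 else if q = 4 then 1 else if q = 3 then 1 else 0) = 1) then 1 else 0) + 1) := by
    intro c
    obtain ⟨Z, mult, hZ, hmZ⟩ := multiplicity_transfer_iteratedDeriv (N := m c) (-R) R
      (fun k t => ε c * (μ c k)⁻¹ * (∑ l, Real.exp (δs (φ k) l * t) • (Real.exp (δs (φ k) l * s c k) • U (φ k) l)).det)
      (fun t => ((Real.exp (δ0 0 * t)) • (W c 0 + t • W c 5) + (Real.exp (δ0 1 * t)) • (W c 1 + t • W c 4)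
          + (Real.exp (δ0 2 * t)) • (W c 2 + t • W c 3)).det)
      (fun k nn => contDiff_const.mul (contDiff_pencilDet _ _ nn))
      (fun j _ ψ hψ ts t₀ _ hts => hconv c j ψ hψ ts t₀ hts)
      (fun k => by
        obtain ⟨x, hx, hx'⟩ := hzeros c k
        exact ⟨x, hx, fun i => ⟨(hx' i).1, by rw [(hx' i).2, mul_zero]⟩⟩)
    have hLP := threePairDet_zerosWithMultiplicityLE_slots δ0 h50 h41 h32 (W c) (hneW c) Z mult
      (fun z' hz' => ⟨Set.mem_univ _, (hZ z' hz').2⟩)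
    have hS1 : 1 ≤ ∑ w ∈ V.filter (fun w => (∃ p q : Fin 6, δ0 p + δ0 q = w ∧ polar (W c p) (W c q) ≠ 0)),
        ((if (∃ p q : Fin 6, δ0 p + δ0 q = w ∧ polar (W c p) (W c q) ≠ 0 ∧ (if p = 5 then 1 else if p = 4 then 1 else if p = 3 then 1 else 0) + (if q = 5 then 1 else if q = 4 then 1 else if q = 3 then 1 else 0) = 2) then 2
          else if (∃ p q : Fin 6, δ0 p + δ0 q = w ∧ polar (W c p) (W c q) ≠ 0 ∧ (if p = 5 then 1 else if p = 4 then 1 else if p = 3 then 1 else 0) + (if q = 5 then 1 else if q = 4 then 1 else if q = 3 then 1 else 0) = 1) then 1 else 0) + 1) := by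
      obtain ⟨w₀, hw₀⟩ := hne' c
      exact le_trans (Nat.le_add_left 1 _) (Finset.single_le_sum
        (f := fun w => (if (∃ p q : Fin 6, δ0 p + δ0 q = w ∧ polar (W c p) (W c q) ≠ 0 ∧ (if p = 5 then 1 else if p = 4 then 1 else if p = 3 then 1 else 0) + (if q = 5 then 1 else if q = 4 then 1 else if q = 3 then 1 else 0) = 2) then 2
          else if (∃ p q : Fin 6, δ0 p + δ0 q = w ∧ polar (W c p) (W c q) ≠ 0 ∧ (if p = 5 then 1 else if p = 4 then 1 else if p = 3 then 1 else 0) + (if q = 5 then 1 else if q = 4 then 1 else if q = 3 then 1 else 0) = 1) then 1 else 0) + 1)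
        (fun w _ => Nat.zero_le _) hw₀)
    have hmZ' : m c ≤ ∑ z' ∈ Z, mult z' := hmZ
    have hLP' : ∑ z' ∈ Z, mult z' ≤ (∑ w ∈ V.filter (fun w => (∃ p q : Fin 6, δ0 p + δ0 q = w ∧ polar (W c p) (W c q) ≠ 0)),
        ((if (∃ p q : Fin 6, δ0 p + δ0 q = w ∧ polar (W c p) (W c q) ≠ 0 ∧ (if p = 5 then 1 else if p = 4 then 1 else if p = 3 then 1 else 0) + (if q = 5 then 1 else if q = 4 then 1 else if q = 3 then 1 else 0) = 2) then 2
          else if (∃ p q : Fin 6, δ0 p + δ0 q = w ∧ polar (W c p) (W c q) ≠ 0 ∧ (if p = 5 then 1 else if p = 4 then 1 else if p = 3 then 1 else 0) + (if q = 5 then 1 else if q = 4 then 1 else if q = 3 then 1 else 0) = 1) then 1 else 0) + 1)) - 1 := hLP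
    omega
  -- (hmono) tropical monotonicity of the active value sets
  have hmono' : ∀ c c' : Fin C, c < c' →
      ∀ w ∈ V.filter (fun w => (∃ p q : Fin 6, δ0 p + δ0 q = w ∧ polar (W c p) (W c q) ≠ 0)), ∀ w' ∈ V.filter (fun w => (∃ p q : Fin 6, δ0 p + δ0 q = w ∧ polar (W c' p) (W c' q) ≠ 0)), w ≤ w' := by
    intro c c' hcc' w hw w' hw'
    obtain ⟨-, p, q, rfl, hpq⟩ := Finset.mem_filter.mp hw
    obtain ⟨-, p', q', rfl, hp'q'⟩ := Finset.mem_filter.mp hw'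
    exact Rmono c c' hcc' p q p' q' ((hal c p q).mp hpq) ((hal c' p' q').mp hp'q')
  -- (hsplit) slot splitting, value by value (this seat's `threePair_hsplit`)
  have hsplit : ∀ w ∈ V, (∑ c : Fin C, (if w ∈ V.filter (fun w => (∃ p q : Fin 6, δ0 p + δ0 q = w ∧ polar (W c p) (W c q) ≠ 0))
        then (if (∃ p q : Fin 6, δ0 p + δ0 q = w ∧ polar (W c p) (W c q) ≠ 0 ∧ (if p = 5 then 1 else if p = 4 then 1 else if p = 3 then 1 else 0) + (if q = 5 then 1 else if q = 4 then 1 else if q = 3 then 1 else 0) = 2) then 2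
          else if (∃ p q : Fin 6, δ0 p + δ0 q = w ∧ polar (W c p) (W c q) ≠ 0 ∧ (if p = 5 then 1 else if p = 4 then 1 else if p = 3 then 1 else 0) + (if q = 5 then 1 else if q = 4 then 1 else if q = 3 then 1 else 0) = 1) then 1 else 0) else 0)) ≤ (fun _ : ℝ => 3) w - 1 := by
    intro w hw
    rw [hV, Finset.mem_image] at hw
    obtain ⟨pq, -, rfl⟩ := hw
    exact threePair_hsplit δ0 h50 h41 h32 hvg Γ W hal hΓsymm Rtop₀₅ Rmid₀₅ Rthree₀₅ Rtop₁₄ Rmid₁₄ Rthree₁₄ Rtop₂₃ Rmid₂₃ Rthree₂₃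
      Mtop₀₁ Mmid₀₁ Mthree₀₁ Mtop₀₂ Mmid₀₂ Mthree₀₂ Mtop₁₂ Mmid₁₂ Mthree₁₂ pq.1 pq.2 _ rfl
  -- the ceiling: `20 = Σ m_c ≤ 2|V| + (|V| − 1) ≤ 17`
  have hcc := chain_ceiling V (fun _ => 3)
    (fun c => V.filter (fun w => (∃ p q : Fin 6, δ0 p + δ0 q = w ∧ polar (W c p) (W c q) ≠ 0)))
    (fun c w => (if (∃ p q : Fin 6, δ0 p + δ0 q = w ∧ polar (W c p) (W c q) ≠ 0 ∧ (if p = 5 then 1 else if p = 4 then 1 else if p = 3 then 1 else 0) + (if q = 5 then 1 else if q = 4 then 1 else if q = 3 then 1 else 0) = 2) then 2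
          else if (∃ p q : Fin 6, δ0 p + δ0 q = w ∧ polar (W c p) (W c q) ≠ 0 ∧ (if p = 5 then 1 else if p = 4 then 1 else if p = 3 then 1 else 0) + (if q = 5 then 1 else if q = 4 then 1 else if q = 3 then 1 else 0) = 1) then 1 else 0)) m
    hne' (fun c => Finset.filter_subset _ _) hmono' hsplit hcount
  simp only [Finset.sum_const, smul_eq_mul] at hcc
  omega

end Summit.ValiantsHypothesis.ValiantsHypothesis.Theorems.LacunarySymmetroidMatrixDescartes.WallBubbling
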